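import Literature.Computability.Complexity.SuccinctWitnessesFromUWC
import Literature.Computability.Complexity.EasyWitness
import HarnessLib

/-!
# Universal witness circuits under `NEXP ⊆ P/poly` (Williams 2014, Thm. 5.2): the printed proof

Literature / circuit complexity (serves `williams_acc` through `Williams2014Transfer.lean`).
`Williams2014Transfer.lean` vendors, as the leaf under Williams' Thm. 5.1 (succinct satisfying
assignments; `Williams2014_thm_5_1`, derived from the leaf in `SuccinctWitnessesFromUWC.lean`),
the named fact `Williams2014_thm_5_2`: "If `NEXP ⊆ P/poly` then every language in `NEXP` has
universal witness circuits of polynomial size" (Williams 2014, Thm. 5.2, citing [IKW02, Wil10];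
= Williams 2010, Lemma 3.1, "follows from [IKW02]; we include a proof for completeness in
Appendix A"; the single-verifier form is Impagliazzo–Kabanets–Wigderson 2002, Thm. 31). This file
opens that leaf along its printed proof (Williams 2010, Appendix A), which is the easy-witness
argument of IKW's Thm. 24 with "`NEXP ≠ EXP`" replaced by "some verifier has no witness
circuits":

1. a verifier without witness circuits accepts, on infinitely many hard inputs, only witnesses of
   high circuit complexity; guessing such a witness and feeding it to the pseudorandom generator
   of [BFNW93, KvM99] simulates `MA` infinitely often in nondeterministic time `2^{n^ε}` with
   `n^ε` bits of advice (the hard input) — vendored here as the named fact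
   `Williams2010_MA_io_of_not_witnessCircuits` (the analogue, for universal witnesses, of the
   leaf `IKW2002_thm18_MA` of `EasyWitness.lean`; both are IKW's Thm. 12 (2) run on guessed
   certificates);
2. `EXP ⊆ P/poly ⟹ EXP = MA` [BFNW93] — the leaf `EXP_eq_MA_of_subset_PPoly` of
   `EasyWitness.lean` (IKW Thm. 22);
3. under `NEXP ⊆ P/poly`, `NTIME[2ⁿ]/n` has circuits of a fixed polynomial size and `EXP` has
   none infinitely often, "by a simple diagonalization argument" — IKW Lemma 5 and Thm. 2, the
   leaves `IKW2002_lemma5`, `IKW2002_thm2` of `EasyWitness.lean`, combined there into the theorem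
   `IKW2002_cor8` (`NEXP ⊆ P/poly ⟹ EXP ⊄ io-[NTIME(2ⁿ)/n]`).

PROVED here: `Williams2014_thm_5_2_of_components` (Thm. 5.2 from 1–3),
`Williams2014_thm_5_1_of_components`, and `williams_acc_of_easyWitness_components` — Williams'
Theorem 1.1 (`NTIME(2ⁿ) ⊄ ACC⁰`) from Fact 3.1, the three easy-witness leaves, Thm. 3.2 with
Lemma 3.1, the nondeterministic time hierarchy theorem and the `ACC`-SAT algorithm of Thm. 4.1.
After this file the trust base of `Williams2014_thm_5_1` is
{`EXP_eq_MA_of_subset_PPoly`, `Williams2010_MA_io_of_not_witnessCircuits`, `IKW2002_lemma5`,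
`IKW2002_thm2`}, three of which it shares with `NEXP_eq_EXP_of_subset_PPoly`
(`NEXP_eq_EXP_of_subset_PPoly_of_IKW`).

## Rendering (as in `EasyWitness.lean`)

* verifiers are the correct `2^{nᵏ}`-time verifiers `NVerifier` of `Williams2014Transfer.lean`
  (Williams 2014, §5: "every correct exponential time verifier"); "`V` has witness circuits of
  polynomial size" is the `(k, V)`-instance `NVerifier.HasWitnessCircuits` of
  `HasUniversalWitnessCircuits` (`hasUniversalWitnessCircuits_iff` is `Iff.rfl`);
* `MA` is `MA = MA(2)` of `ArthurMerlinGames.lean`; `io` is the operator of `Classes.lean`;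
  `C/ℓ` with `O(ℓ)` advice is `advice C ℓ` (`EasyWitness.lean`); "for every `ε > 0` … `2^{n^ε}`,
  `n^ε`" with real `ε` is `2 ^ ⌈(n : ℝ) ^ ε⌉₊`, `⌈(n : ℝ) ^ ε⌉₊`; only `ε = 1` is used in the
  assembly (`Williams2010_MA_io_of_not_witnessCircuits.two_pow`).

Mathlib has no complexity classes; nothing here duplicates Mathlib or the tree (searched
`universal witness`, `HasWitnessCircuits`, `io (advice`, `Williams2010`).

## References

* R. Williams, *Nonuniform ACC circuit lower bounds*, J. ACM 61 (2014) 2:1–2:32, §5, Thm. 5.1,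
  Thm. 5.2 ("The proof of Theorem 5.2 follows an argument by Impagliazzo, Kabanets, and
  Wigderson [IKW02]") [Williams2014].
* R. Williams, *Improving exhaustive search implies superpolynomial lower bounds*, STOC 2010,
  231–240, Def. 3.2, Lemma 3.1 and Appendix A (proof of Lemma 3.1) [Williams2010STOC] (text
  checked: held as `paper:doi-10-1145-1806689-1806723`, pp. 9 and 25).
* R. Impagliazzo, V. Kabanets, A. Wigderson, *In search of an easy witness: exponential time vs.
  probabilistic polynomial time*, JCSS 65 (2002) 672–694, Thm. 2, Lemma 5, Cor. 8, Thms. 11–12,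
  Lemma 17, Thm. 22, Thm. 24, Thm. 31 [ImpagliazzoKabanetsWigderson2002].
-/

noncomputable section

namespace Literature.Computability.Complexity

open Filter

/-! ### Witness circuits for one verifier -/

/-- **Witness circuits of polynomial size for ONE verifier** — the `(k, V)`-instance of
`HasUniversalWitnessCircuits` (Williams 2014, §5: "for every `x ∈ L`, there is a circuit of size
at most `|x|ᶜ + c` which encodes a witness for `x` that is accepted by the verifier"; Williams
2010, Def. 3.2): there is `c` such that every `x ∈ L` has a witness `y` accepted by `V` (inside
`V`'s length bound) which is a prefix of the truth table of a `B₂`-circuit with at most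
`|x|ᶜ + c` gates. [cite: Williams2014, §5 (before Thm. 5.2)] -/
def NVerifier.HasWitnessCircuits {k : ℕ} {L : Language Bool}
    (V : NVerifier (fun n => 2 ^ (n ^ k)) L) : Prop :=
  ∃ c : ℕ, ∀ x ∈ L, ∃ (m : ℕ) (W : Circuit (Fin m)) (y : List Bool),
    W.IsOver B2 ∧ W.size ≤ x.length ^ c + c ∧ y.length ≤ V.c * 2 ^ (x.length ^ k) + V.c ∧
      V.rel x y = true ∧ y <+: MetaComplexity.truthTable W.eval

/-- `HasUniversalWitnessCircuits L` says exactly that every correct exponential-time verifier for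
`L` has witness circuits of polynomial size (definitional unfolding). [cite: Williams2014, §5] -/
theorem hasUniversalWitnessCircuits_iff (L : Language Bool) :
    HasUniversalWitnessCircuits L ↔
      ∀ (k : ℕ) (V : NVerifier (fun n => 2 ^ (n ^ k)) L), V.HasWitnessCircuits :=
  Iff.rfl

/-! ### The derandomization leaf (Williams 2010, App. A; IKW 2002, Thm. 12 (2) with Lemma 17) -/

/-- **Williams 2010, Appendix A (proof of Lemma 3.1 = Williams 2014, Thm. 5.2), first half: an
infinitely-often nondeterministic simulation of `MA` with sublinear advice from a verifier without
witness circuits.** Printed: "Suppose there is an `L ∈ NEXP` which does not have universal witness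
circuits. Let `c > 0` be such that `L ∈ NTIME[2^{n^c}]`. Then there is some correct verifier `V`
for `L` such that for all constants `d ≥ 1`, there is an infinite sequence of inputs
`S = {x_{i_k}}` with the properties: for all `k`, `x_{i_k} ∈ L` and for all sufficiently large `k`
and all `y` of length `2^{|x_{i_k}|^c}`, `V(x_{i_k}, y) = 1` implies that the circuit complexity of
the function `f(x_{i_k}, i) = yᵢ` is greater than `|x_{i_k}|^d`. […] We can simulate `MA`
infinitely often in nondeterministic time `O(2^{n^ε})` with `n^ε` bits of advice, as follows"
[advice for length `n`: a hard input `x_{i_ℓ} ∈ S` of length `n^{εa}` (or `0ⁿ`); guess a witness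
`y` with `V(x_{i_ℓ}, y) = 1`; guess Merlin's string; simulate Arthur — a circuit of size `nᵃ` — on
the outputs of the generator `G` of [BFNW93, KvM99] armed with `y` over all `n^ε` seeds and take
the majority answer; `G` fools Arthur since `d` is arbitrary] "… we have established
`MA ⊆ i.o.-NTIME[2^{n^{ε'}}]/n^{ε'}` for all `ε' > 0`." This is Impagliazzo–Kabanets–Wigderson
2002, Thm. 12 (2) ("If the Boolean functions `fₙ` … for every `d ∈ ℕ` and infinitely many `n`,
`fₙ` has circuit complexity greater than `n^d`, then, for every `ε > 0`,
`MA ⊆ io-[NTIME(2^{n^ε})/a(n^ε)]`") applied, as in their Lemma 17 and Thm. 31, to the truth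
tables generated by guessing witnesses of `V` on hard inputs given as advice.

Rendering: `V` ranges over the correct `2^{nᵏ}`-time verifiers `NVerifier` (Williams 2014, §5:
"every correct exponential time verifier"); the hypothesis is the negation of
`V.HasWitnessCircuits` — for every `c` some `x ∈ L` has no accepted witness that is a prefix of the
truth table of a `B₂`-circuit with `≤ |x|ᶜ + c` gates; as printed this yields infinitely many such
`x` for every `c`, since each single `x ∈ L` has some accepted witness and every string is a
prefix of the truth table of some circuit — ; `MA = MA(2)` (`ArthurMerlinGames.lean`), `io`
(`Classes.lean`), `advice` with `O(·)` advice (`EasyWitness.lean`), `2^{n^ε} ↦ 2 ^ ⌈n^ε⌉₊` for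
real `ε > 0` (the `O(·)` slack and the rounding are absorbed by taking `ε` smaller, as in the
printed "setting `ε > 0` to be arbitrarily small"). Named fact: the discharge needs the
pseudorandom generator from worst-case-hard functions (IKW Thm. 11 = [BFNW93, KvM99]; the tree
has only the combinatorial layer of the Nisan–Wigderson generator, `MetaComplexity/NWGenerator.lean`)
and the advice-taking nondeterministic `TM2` simulation of an `MA(2)` game.
[cite: Williams2010STOC, Appendix A (proof of Lemma 3.1)]
[cite: ImpagliazzoKabanetsWigderson2002, Thm. 12 (2) and Lemma 17] -/
def Williams2010_MA_io_of_not_witnessCircuits : Prop :=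
  ∀ (L : Language Bool) (k : ℕ) (V : NVerifier (fun n => 2 ^ (n ^ k)) L), ¬ V.HasWitnessCircuits →
    ∀ ε : ℝ, 0 < ε →
      MA ⊆ io (advice (NTIME fun n => 2 ^ ⌈(n : ℝ) ^ ε⌉₊) fun n => ⌈(n : ℝ) ^ ε⌉₊)

/-- The member `ε' = 1` of the leaf: without witness circuits for some verifier,
`MA ⊆ i.o.-NTIME[2ⁿ]/n` — the instance used in the proof of Lemma 3.1 / Thm. 5.2 ("Hence …
`EXP = MA ⊆ i.o.-NTIME[2ⁿ]/n ⊆ i.o.-SIZE[O(n^q)]`").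
[cite: Williams2010STOC, Appendix A (proof of Lemma 3.1)] -/
theorem Williams2010_MA_io_of_not_witnessCircuits.two_pow
    (h : Williams2010_MA_io_of_not_witnessCircuits) {L : Language Bool} {k : ℕ}
    (V : NVerifier (fun n => 2 ^ (n ^ k)) L) (hV : ¬ V.HasWitnessCircuits) :
    MA ⊆ io (advice (NTIME fun n => 2 ^ n) fun n => n) := by
  have h1 := h L k V hV 1 one_pos
  simpa only [Real.rpow_one, Nat.ceil_natCast] using h1

/-! ### Theorem 5.2 and Theorem 5.1 from the easy-witness components -/

/-- **Williams 2014, Thm. 5.2 (= Williams 2010, Lemma 3.1; cf. IKW 2002, Thm. 31) from the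
components of its printed proof** (Williams 2010, App. A): under `NEXP ⊆ P/poly`, if some
`L ∈ NEXP` had a verifier without witness circuits, then `MA ⊆ i.o.-NTIME[2ⁿ]/n`
(`Williams2010_MA_io_of_not_witnessCircuits`); `EXP ⊆ NEXP ⊆ P/poly` gives `EXP = MA`
([BFNW93]; IKW Thm. 22, `EXP_eq_MA_of_subset_PPoly`), hence `EXP ⊆ i.o.-NTIME[2ⁿ]/n`; but "since
`NEXP ⊆ P/poly`, there is a fixed constant `q` such that `NTIME[2ⁿ]/n` has circuits of size
`O(n^q)`" (IKW Lemma 5, `IKW2002_lemma5`) and `EXP ⊄ i.o.-SIZE[O(n^q)]` "by a simple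
diagonalization argument" (IKW Thm. 2, `IKW2002_thm2`) — together IKW Cor. 8 (`IKW2002_cor8`,
proved in `EasyWitness.lean`). [cite: Williams2014, Thm. 5.2]
[cite: Williams2010STOC, Lemma 3.1 and Appendix A]
[cite: ImpagliazzoKabanetsWigderson2002, Thm. 31 (cf. Thm. 24)] -/
theorem Williams2014_thm_5_2_of_components (h22 : EXP_eq_MA_of_subset_PPoly)
    (hA : Williams2010_MA_io_of_not_witnessCircuits) (h5 : IKW2002_lemma5) (h2 : IKW2002_thm2) :
    Williams2014_thm_5_2 := by
  intro hNP L _hL k V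
  by_contra hV
  have hMA : MA ⊆ io (advice (NTIME fun n => 2 ^ n) fun n => n) := hA.two_pow V hV
  have hEXP : EXP = MA := h22 (EXP_subset_NEXP.trans hNP)
  exact IKW2002_cor8 h5 h2 hNP (hEXP ▸ hMA)

/-- **Williams 2014, Thm. 5.1 from the easy-witness components**: Thm. 5.2 from its components
(`Williams2014_thm_5_2_of_components`) followed by Thm. 5.1 from Thm. 5.2
(`Williams2014_thm_5_1_of_thm_5_2`, `SuccinctWitnessesFromUWC.lean`).
[cite: Williams2014, Thm. 5.1 and Thm. 5.2] -/
theorem Williams2014_thm_5_1_of_components (h22 : EXP_eq_MA_of_subset_PPoly)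
    (hA : Williams2010_MA_io_of_not_witnessCircuits) (h5 : IKW2002_lemma5) (h2 : IKW2002_thm2) :
    Williams2014_thm_5_1 :=
  Williams2014_thm_5_1_of_thm_5_2 (Williams2014_thm_5_2_of_components h22 hA h5 h2)

/-- **Williams' Theorem 1.1 (`NTIME(2ⁿ) ⊄ ACC⁰`, `williams_acc`) with the IKW leaf opened**:
Fact 3.1 (efficient succinct Cook–Levin), the derandomization leaf of Williams 2010 App. A,
`EXP ⊆ P/poly ⟹ EXP = MA`, IKW Lemma 5 and Thm. 2, Thm. 3.2 with Lemma 3.1, the nondeterministic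
time hierarchy theorem and the `ACC`-SAT algorithm of Thm. 4.1 imply `williams_acc`
(through `williams_acc_of_ikw_components`). [cite: Williams2014, Thm. 1.1 and its proof] -/
theorem williams_acc_of_easyWitness_components (h31 : Williams2014_fact_3_1)
    (h22 : EXP_eq_MA_of_subset_PPoly) (hA : Williams2010_MA_io_of_not_witnessCircuits)
    (h5 : IKW2002_lemma5) (h2 : IKW2002_thm2) (h32 : Williams2014_thm_3_2) (hH : ntime_hierarchy)
    (h41 : Williams2014_accSat_polysize) : williams_acc :=
  williams_acc_of_ikw_components h31 (Williams2014_thm_5_2_of_components h22 hA h5 h2) h32 hH h41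

end Literature.Computability.Complexity

end
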